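import Summits.NavierStokesRegularity.NavierStokesRegularity.Theorems.TypeIIInviscidRelaxationAxisymSwirlRegularOfNoBlowup
import Summits.NavierStokesRegularity.NavierStokesRegularity.Theorems.ScenarioCensusRowF5lg
import Literature.Analysis.FluidPDE.ClayClassLerayHopfUniqueness
import HarnessLib

/-!
# Crux `AxisymSwirlRegular` (stmt-NavierStokesRegularity-1964, route `TypeIIInviscidRelaxation`):
# the registered line `radial_inflow_split` is TIGHT — both stubs are implied by the crux, and the
# crux is equivalent to ONE a-priori inflow bound at a subcritical constant

`--supports stmt-NavierStokesRegularity-1964` (helper file; theorems only, no new definitions).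

The registered skeleton `Cruxes/AxisymSwirlRegular/Lines/radial_inflow_split.lean` proves
`AxisymSwirlRegular` from two stubs, both verbatim route decls of `Theses/TypeIIInviscidRelaxation`:
`stub_oneSidedRadialCriterion = OneSidedRadialCriterion` (⟨19059⟩, X₁: `r u_r ≥ −Cν` on an axis
tube, ANY `C` ⇒ extension past `T`) and `stub_aprioriRadialInflowBound = AprioriRadialInflowBound`
(⟨19060⟩, X₂: every solution of the standing class has such a bound for SOME `C`). This file
records, in kernel, how much of the crux each stub carries:

* `exists_global_classical_of_axisymSwirlRegular` — under the crux, every solution of the standing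
  axisymmetric class on `[0,T)` (classical on `[0,T)`, Leray–Hopf on `[0,T]` from its rapidly
  decaying axisymmetric datum) is the restriction of a GLOBAL classical bounded-energy solution,
  which is moreover BOUNDED on `[0,T] × ℝ³`. Ingredients (all theorems of the tree): the crux applied
  to the datum `u 0`; Tao 2013 Lemma 8.1 + Cor. 11.1 + Prodi–Serrin
  (`IsNavierStokesSolution.ae_eq_of_isLerayHopfOn`: the Leray–Hopf solution agrees a.e. with the
  Clay-class one, hence pointwise by continuity); Tao 2013 Cor. 11.1 + Sobolev
  (`tao2011_hasBoundedSobolevNormsOn_holds`, `linfty_bound_of_hasBoundedSobolevNormsOn_holds`).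
* `oneSidedRadialCriterion_and_aprioriRadialInflowBound_of_axisymSwirlRegular :
  AxisymSwirlRegular → OneSidedRadialCriterion ∧ AprioriRadialInflowBound` (BY NAME, as one
  conjunction: no declaration here has a route item as its bare conclusion, nothing closes ⟨19059⟩ /
  ⟨19060⟩): both stubs are NECESSARY; with the registered composition (here through
  `axisymSwirlRegular_of_noBlowup`) `axisymSwirlRegular_iff_oneSidedRadialCriterion_and_aprioriRadialInflowBound :
  AxisymSwirlRegular ↔ OneSidedRadialCriterion ∧ AprioriRadialInflowBound` — the split loses nothing
  and gains nothing: each piece is implied by the crux.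
* `axisymSwirlRegular_iff_aprioriRadialInflowBound_one` — the crux is EQUIVALENT to the single
  a-priori estimate «every solution of the standing class has `x₀u₀ + x₁u₁ = r u_r ≥ −ν` on some axis
  tube `{cylRadius < δ} × [0,T)`» (X₂ at the constant `C = 1 < 2`): sufficiency is the landed
  subcritical one-sided criterion `ScenarioCensus.LogGate.oneSidedRadialCriterion_of_lt_two`
  (Wei 2016 via the log gate; print: X. Pan 2017 `C = 1`, Zujin Zhang 2018 `1 < C < 2`), necessity
  is boundedness. So the line's open content is exactly ONE scale-critical a-priori bound on the
  radial inflow near the axis, at any fixed subcritical constant; X₁ for `C ≥ 2` (the open half of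
  ⟨19059⟩, `oneSidedRadialCriterion_iff_geTwo`) is not needed.
* `axisymSwirlRegular_iff_row_F5` — the census row `ScenarioCensus.Row_F5` (continuation form: no
  blow-up in the standing axisymmetric class) is EQUIVALENT to the crux (data form), BY NAME.

WHAT THIS IS NOT: no stub is proved; `AxisymSwirlRegular` (= ns.S25, axisymmetric regularity with
swirl) stays OPEN; NS regularity is not touched. [folklore assembly of cited tree theorems]

References: T. Tao, *Localisation and compactness properties of the Navier–Stokes global regularity
problem*, Anal. PDE 6 (2013) 25–107, Lemma 8.1, Cor. 11.1 [Tao2013Localisation]; J. Serrin, in: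
Nonlinear Problems (1963), Thm. 6 [Serrin1963]; D. Wei, J. Math. Anal. Appl. 435 (2016) 402–413
[Wei2016]; X. Pan, Acta Appl. Math. 150 (2017) 103–109; G. Koch, N. Nadirashvili, G. Seregin,
V. Šverák, Acta Math. 203 (2009) 83–105, §5 [KNSS2009].
-/

noncomputable section

open Literature.Analysis.FluidPDE MeasureTheory Set Function Filter Topology Metric
open scoped ENNReal NNReal

namespace Summit.NavierStokesRegularity.NavierStokesRegularity.Theorems

-- the problem directory repeats the summit name (`NavierStokesRegularity/NavierStokesRegularity`)
set_option linter.dupNamespace false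

open Summit.NavierStokesRegularity.NavierStokesRegularity.Theses.TypeIIInviscidRelaxation
  (AxisymSwirlRegular OneSidedRadialCriterion AprioriRadialInflowBound)

/-- **Under the crux, every solution of the standing axisymmetric class is the restriction of a
bounded global classical solution.** Let `AxisymSwirlRegular` hold, `ν, T > 0`, and let `(u, p)` be
classical on `[0,T) × ℝ³`, Leray–Hopf on `[0,T]` from `u 0`, with `u 0` axisymmetric and rapidly
decaying. Then there is a classical solution `(U, P)` on `[0,∞) × ℝ³` with bounded energy, equal to
`u` on every slice `t ∈ [0,T)`, and bounded on `[0,T] × ℝ³`. Proof: the crux gives `(U, P)` from the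
Clay datum `u 0`; by Tao 2013 (Lemma 8.1, Cor. 11.1) and Prodi–Serrin weak–strong uniqueness
(`IsNavierStokesSolution.ae_eq_of_isLerayHopfOn`) `u t = U t` a.e. for `0 < t ≤ T`, hence everywhere
on `[0,T)` by continuity of both slices; boundedness on the closed slab is Tao 2013 Cor. 11.1 with
the Sobolev imbedding (`tao2011_hasBoundedSobolevNormsOn_holds`,
`linfty_bound_of_hasBoundedSobolevNormsOn_holds`). [cite: Tao2013Localisation, Lemma 8.1 and Cor. 11.1] -/
theorem exists_global_classical_of_axisymSwirlRegular (hAX : AxisymSwirlRegular) {ν T : ℝ}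
    (hν : 0 < ν) (hT : 0 < T)
    {u : ℝ → EuclideanSpace ℝ (Fin 3) → EuclideanSpace ℝ (Fin 3)}
    {p : ℝ → EuclideanSpace ℝ (Fin 3) → ℝ}
    (hcl : IsClassicalNSSolutionOn (Ico 0 T) ν 0 u p) (hLH : IsLerayHopfOn T ν 0 (u 0) u)
    (hax0 : IsAxisymmetric (u 0)) (hdec : HasRapidSpatialDecay (u 0)) :
    ∃ (U : ℝ → EuclideanSpace ℝ (Fin 3) → EuclideanSpace ℝ (Fin 3))
      (P : ℝ → EuclideanSpace ℝ (Fin 3) → ℝ),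
      IsClassicalNSSolutionOn (Ici 0) ν 0 U P ∧ HasBoundedEnergy U ∧ (∀ t ∈ Ico 0 T, U t = u t) ∧
        ∃ B : ℝ, ∀ t ∈ Icc 0 T, ∀ x, ‖U t x‖ ≤ B := by
  have h0T : (0 : ℝ) ∈ Ico 0 T := left_mem_Ico.2 hT
  have hsm : ContDiff ℝ (⊤ : ℕ∞) (u 0) := hcl.contDiff_velocity h0T
  have hdiv : VectorCalculus.IsDivFree (u 0) := hcl.divFree 0 h0T
  obtain ⟨U, P, hU, hU0, hE⟩ := hAX ν hν (u 0) hsm hdiv hdec (fun θ x => hax0 θ x)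
  obtain ⟨hns, hUs, hPs⟩ := isNavierStokesSolution_and_smooth_iff.2 ⟨hU, hU0⟩
  -- Tao 2013 + Prodi–Serrin: the Leray–Hopf solution `u` agrees a.e. with the Clay-class `U`
  have hae : ∀ t ∈ Ioc 0 T, u t =ᵐ[volume] U t :=
    hns.ae_eq_of_isLerayHopfOn hν hT hdec hUs hPs hE hLH
  have hagree : ∀ t ∈ Ico 0 T, U t = u t := by
    intro t ht
    rcases eq_or_lt_of_le ht.1 with h0 | hpos
    · rw [← h0]
      exact hU0
    · have hcu : Continuous (u t) := (hcl.contDiff_velocity ht).continuous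
      have hcU : Continuous (U t) := (hU.contDiff_velocity (mem_Ici.2 ht.1)).continuous
      exact ((Continuous.ae_eq_iff_eq volume hcu hcU).1 (hae t ⟨hpos, ht.2.le⟩)).symm
  -- Tao 2013 Cor. 11.1 + Sobolev: `U` is bounded on the closed slab `[0, T] × ℝ³`
  have hclT : IsClassicalNSSolutionOn (Icc 0 T) ν 0 U P :=
    hU.mono Icc_subset_Ici_self (uniqueDiffOn_Icc hT)
  have hE' : ∃ C : ℝ≥0∞, C < ⊤ ∧ ∀ t ∈ Icc 0 T, ∫⁻ x, ‖U t x‖ₑ ^ 2 ≤ C := by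
    obtain ⟨C, hC, hb⟩ := hE
    exact ⟨C, hC, fun t ht => hb t ht.1⟩
  have hdec0 : HasRapidSpatialDecay (U 0) := by
    rw [hU0]
    exact hdec
  have hH : HasBoundedSobolevNormsOn (Icc 0 T) U :=
    (tao2011_hasBoundedSobolevNormsOn.closedSlab tao2011_hasBoundedSobolevNormsOn_holds
      linfty_bound_of_hasBoundedSobolevNormsOn_holds ν T hν hT U P hclT hE' hdec0).1
  have hC2 : ∀ t ∈ Icc 0 T, ContDiff ℝ 2 (U t) := fun t ht =>
    (hclT.contDiff_velocity ht).of_le (by norm_cast)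
  obtain ⟨B, hB⟩ := linfty_bound_of_hasBoundedSobolevNormsOn_holds hC2 hH
  exact ⟨U, P, hU, hE, hagree, B, hB⟩

/-- **Under the crux, the standing axisymmetric class has no blow-up and is bounded up to `T`.**
For `(u, p)` classical on `[0,T)`, Leray–Hopf on `[0,T]` from its axisymmetric rapidly decaying datum:
`HasSmoothExtensionPast ν 0 u T`, and `‖u t x‖ ≤ B` on `[0,T) × ℝ³` for some `B`. (Corollary of
`exists_global_classical_of_axisymSwirlRegular`: restrict the global solution to `[0, T+1)`.) [folklore] -/
theorem hasSmoothExtensionPast_and_bounded_of_axisymSwirlRegular (hAX : AxisymSwirlRegular)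
    {ν T : ℝ} (hν : 0 < ν) (hT : 0 < T)
    {u : ℝ → EuclideanSpace ℝ (Fin 3) → EuclideanSpace ℝ (Fin 3)}
    {p : ℝ → EuclideanSpace ℝ (Fin 3) → ℝ}
    (hcl : IsClassicalNSSolutionOn (Ico 0 T) ν 0 u p) (hLH : IsLerayHopfOn T ν 0 (u 0) u)
    (hax0 : IsAxisymmetric (u 0)) (hdec : HasRapidSpatialDecay (u 0)) :
    HasSmoothExtensionPast ν 0 u T ∧ ∃ B : ℝ, ∀ t ∈ Ico 0 T, ∀ x, ‖u t x‖ ≤ B := by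
  obtain ⟨U, P, hU, -, hagree, B, hB⟩ :=
    exists_global_classical_of_axisymSwirlRegular hAX hν hT hcl hLH hax0 hdec
  refine ⟨⟨T + 1, by linarith, U, P, hU.mono (fun t ht => mem_Ici.2 ht.1) (uniqueDiffOn_Ico 0 (T + 1)), hagree⟩, B, fun t ht x => ?_⟩
  rw [← hagree t ht]
  exact hB t (Ico_subset_Icc_self ht) x

/-- The radial momentum is controlled by the speed: `-(r ‖v‖) ≤ x₀ v₀ + x₁ v₁` for
`r = cylRadius x` (Cauchy–Schwarz in the horizontal plane). [folklore] -/
theorem neg_cylRadius_mul_norm_le_radialMomentum (x v : EuclideanSpace ℝ (Fin 3)) :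
    -(cylRadius x * ‖v‖) ≤ x 0 * v 0 + x 1 * v 1 := by
  have hr : 0 ≤ cylRadius x := cylRadius_nonneg x
  have hv : 0 ≤ ‖v‖ := norm_nonneg v
  have hr2 : cylRadius x ^ 2 = x 0 ^ 2 + x 1 ^ 2 := cylRadius_sq x
  have hv2 : ‖v‖ ^ 2 = v 0 ^ 2 + v 1 ^ 2 + v 2 ^ 2 := by
    rw [EuclideanSpace.real_norm_sq_eq, Fin.sum_univ_three]
  have hsq : (x 0 * v 0 + x 1 * v 1) ^ 2 ≤ (cylRadius x * ‖v‖) ^ 2 := by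
    rw [mul_pow, hr2, hv2]
    nlinarith [sq_nonneg (x 0 * v 1 - x 1 * v 0), sq_nonneg (v 2),
      add_nonneg (sq_nonneg (x 0)) (sq_nonneg (x 1))]
  exact (abs_le_of_sq_le_sq' hsq (mul_nonneg hr hv)).1

/-- **A bounded field has subcritical radial inflow near the axis:** if `‖u t x‖ ≤ B` on `S × ℝ³`
then `x₀u₀ + x₁u₁ = r u_r ≥ −ν` on the axis tube `cylRadius < ν/(B+1)`, for every `ν > 0`
(`r u_r ≥ −r B`). This is the whole content of the necessity of X₂. [folklore] -/
theorem exists_tube_radialMomentum_ge_neg_of_bound {ν B : ℝ} (hν : 0 < ν) {S : Set ℝ}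
    {u : ℝ → EuclideanSpace ℝ (Fin 3) → EuclideanSpace ℝ (Fin 3)} (hS : S.Nonempty)
    (hB : ∀ t ∈ S, ∀ x, ‖u t x‖ ≤ B) :
    ∃ δ : ℝ, 0 < δ ∧ ∀ t ∈ S, ∀ x, cylRadius x < δ → -ν ≤ x 0 * u t x 0 + x 1 * u t x 1 := by
  obtain ⟨t₀, ht₀⟩ := hS
  have hB0 : 0 ≤ B := (norm_nonneg _).trans (hB t₀ ht₀ 0)
  refine ⟨ν / (B + 1), div_pos hν (by linarith), fun t ht x hx => ?_⟩
  have h1 := neg_cylRadius_mul_norm_le_radialMomentum x (u t x)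
  have h2 : cylRadius x * ‖u t x‖ ≤ ν / (B + 1) * B :=
    mul_le_mul hx.le (hB t ht x) (norm_nonneg _) (div_pos hν (by linarith)).le
  have h3 : ν / (B + 1) * B ≤ ν := by
    rw [div_mul_eq_mul_div, div_le_iff₀ (by linarith : (0 : ℝ) < B + 1)]
    nlinarith
  linarith

/-- **Both stubs are necessary: `AxisymSwirlRegular → OneSidedRadialCriterion ∧ AprioriRadialInflowBound`**
(route decls ⟨19059⟩, ⟨19060⟩ BY NAME; stated as ONE conjunction so that no declaration of this file
has a route item as its bare conclusion — nothing here closes ⟨19059⟩ or ⟨19060⟩). Under the crux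
every solution of the standing class extends past `T` whatever its radial inflow (X₁), and is
bounded by some `B ≥ 0` on `[0,T) × ℝ³`, so `r u_r ≥ −r B ≥ −ν` on the tube `cylRadius < ν/(B+1)`
(X₂ with the constant `C = 1`); both from `hasSmoothExtensionPast_and_bounded_of_axisymSwirlRegular`. [folklore] -/
theorem oneSidedRadialCriterion_and_aprioriRadialInflowBound_of_axisymSwirlRegular
    (hAX : AxisymSwirlRegular) : OneSidedRadialCriterion ∧ AprioriRadialInflowBound := by
  refine ⟨fun ν T hν hT u p hcl hLH _hbd hax hdec _hin => ?_, fun ν T hν hT u p hcl hLH _hbd hax hdec => ?_⟩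
  · exact (hasSmoothExtensionPast_and_bounded_of_axisymSwirlRegular hAX hν hT hcl hLH
      (hax 0 (left_mem_Ico.2 hT)) hdec).1
  · obtain ⟨-, B, hB⟩ := hasSmoothExtensionPast_and_bounded_of_axisymSwirlRegular hAX hν hT hcl hLH
      (hax 0 (left_mem_Ico.2 hT)) hdec
    obtain ⟨δ, hδ, hin⟩ := exists_tube_radialMomentum_ge_neg_of_bound hν ⟨0, left_mem_Ico.2 hT⟩ hB
    exact ⟨1, δ, hδ, fun t ht x hx => by simpa only [one_mul] using hin t ht x hx⟩

/-- **The registered split is an equivalence: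
`AxisymSwirlRegular ↔ OneSidedRadialCriterion ∧ AprioriRadialInflowBound`** (⟨1964⟩ ⟺ ⟨19059⟩ ∧ ⟨19060⟩,
all BY NAME). `→`: both pieces are necessary (above). `←`: the registered composition — X₂ bounds
the radial inflow of a standing-class solution, X₁ continues it past `T`, and no blow-up in the
standing class gives the crux (`axisymSwirlRegular_of_noBlowup`). [folklore] -/
theorem axisymSwirlRegular_iff_oneSidedRadialCriterion_and_aprioriRadialInflowBound :
    AxisymSwirlRegular ↔ OneSidedRadialCriterion ∧ AprioriRadialInflowBound := by
  constructor
  · exact oneSidedRadialCriterion_and_aprioriRadialInflowBound_of_axisymSwirlRegular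
  · rintro ⟨hCrit, hBound⟩
    exact axisymSwirlRegular_of_noBlowup fun ν T hν hT u p hcl hLH hbd hax hdec =>
      hCrit ν T hν hT u p hcl hLH hbd hax hdec (hBound ν T hν hT u p hcl hLH hbd hax hdec)

/-- **The crux is ONE subcritical a-priori inflow bound:** `AxisymSwirlRegular` holds iff every
solution of the standing axisymmetric class (classical on `[0,T)`, Leray–Hopf on `[0,T]` from its
datum, bounded on closed sub-slabs, axisymmetric slices, rapidly decaying datum) satisfies
`x₀u₀ + x₁u₁ = r u_r ≥ −ν` on some axis tube `{cylRadius < δ} × [0,T)` (X₂ with `C = 1`). `←`: the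
landed subcritical one-sided criterion `ScenarioCensus.LogGate.oneSidedRadialCriterion_of_lt_two`
(`C = 1 < 2`; Wei 2016 through the log gate) continues every such solution past `T`, and
`axisymSwirlRegular_of_noBlowup` concludes. `→`: boundedness up to `T`
(as in `oneSidedRadialCriterion_and_aprioriRadialInflowBound_of_axisymSwirlRegular`, constant `1`).
Consequently the open half
`C ≥ 2` of X₁ (⟨19059⟩, `ScenarioCensus.LogGate.oneSidedRadialCriterion_iff_geTwo`) is NOT on the
critical path of this line. [cite: Wei2016, Thm. 1.1] -/
theorem axisymSwirlRegular_iff_aprioriRadialInflowBound_one :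
    AxisymSwirlRegular ↔
      ∀ (ν T : ℝ), 0 < ν → 0 < T →
        ∀ (u : ℝ → EuclideanSpace ℝ (Fin 3) → EuclideanSpace ℝ (Fin 3))
          (p : ℝ → EuclideanSpace ℝ (Fin 3) → ℝ),
          IsClassicalNSSolutionOn (Ico 0 T) ν 0 u p → IsLerayHopfOn T ν 0 (u 0) u →
          (∀ T' < T, ∃ M : ℝ, ∀ t ∈ Icc 0 T', ∀ x, ‖u t x‖ ≤ M) →
          (∀ t ∈ Ico 0 T, IsAxisymmetric (u t)) → HasRapidSpatialDecay (u 0) →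
          ∃ δ : ℝ, 0 < δ ∧ ∀ t ∈ Ico 0 T, ∀ x, cylRadius x < δ → -ν ≤ x 0 * u t x 0 + x 1 * u t x 1 := by
  constructor
  · intro hAX ν T hν hT u p hcl hLH _hbd hax hdec
    obtain ⟨-, B, hB⟩ := hasSmoothExtensionPast_and_bounded_of_axisymSwirlRegular hAX hν hT hcl hLH
      (hax 0 (left_mem_Ico.2 hT)) hdec
    exact exists_tube_radialMomentum_ge_neg_of_bound hν ⟨0, left_mem_Ico.2 hT⟩ hB
  · intro hOne
    refine axisymSwirlRegular_of_noBlowup fun ν T hν hT u p hcl hLH hbd hax hdec => ?_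
    obtain ⟨δ, hδ, hin⟩ := hOne ν T hν hT u p hcl hLH hbd hax hdec
    exact ScenarioCensus.LogGate.oneSidedRadialCriterion_of_lt_two (C := 1) hν hT (by norm_num) hδ
      hcl hLH hbd hax hdec (fun t ht x hx => by simpa only [one_mul] using hin t ht x hx)

/-- **Census row F5 (continuation form) ⟺ the crux (data form), BY NAME:**
`AxisymSwirlRegular ↔ ScenarioCensus.Row_F5`. `←` is `axisymSwirlRegular_of_noBlowup` (argument
order of the row); `→` is `hasSmoothExtensionPast_and_bounded_of_axisymSwirlRegular`. [folklore] -/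
theorem axisymSwirlRegular_iff_row_F5 : AxisymSwirlRegular ↔ ScenarioCensus.Row_F5 := by
  constructor
  · intro hAX ν T hν hT u p hcl hLH hdec _hbd hax
    exact (hasSmoothExtensionPast_and_bounded_of_axisymSwirlRegular hAX hν hT hcl hLH
      (hax 0 (left_mem_Ico.2 hT)) hdec).1
  · intro h5
    exact axisymSwirlRegular_of_noBlowup fun ν T hν hT u p hcl hLH hbd hax hdec =>
      h5 ν T hν hT u p hcl hLH hdec hbd hax

/-- **Only the approach to the blow-up time matters:** `AxisymSwirlRegular` holds iff for every
solution of the standing axisymmetric class there are `T' < T` and `δ > 0` with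
`x₀u₀ + x₁u₁ = r u_r ≥ −ν` on `{cylRadius < δ} × [T', T)` — the a-priori inflow bound of
`axisymSwirlRegular_iff_aprioriRadialInflowBound_one` is needed only on a (one-sided) neighbourhood
of `T`, because on the closed slab `[0, T']` the solution is bounded by hypothesis and the bound
holds there on a thinner tube (`exists_tube_radialMomentum_ge_neg_of_bound`). The open content of
the line is therefore an estimate on the radial inflow ALONG SEQUENCES `t ↑ T`, `cylRadius → 0`
only. [folklore] -/
theorem axisymSwirlRegular_iff_aprioriRadialInflowBound_one_nearBlowup :
    AxisymSwirlRegular ↔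
      ∀ (ν T : ℝ), 0 < ν → 0 < T →
        ∀ (u : ℝ → EuclideanSpace ℝ (Fin 3) → EuclideanSpace ℝ (Fin 3))
          (p : ℝ → EuclideanSpace ℝ (Fin 3) → ℝ),
          IsClassicalNSSolutionOn (Ico 0 T) ν 0 u p → IsLerayHopfOn T ν 0 (u 0) u →
          (∀ T' < T, ∃ M : ℝ, ∀ t ∈ Icc 0 T', ∀ x, ‖u t x‖ ≤ M) →
          (∀ t ∈ Ico 0 T, IsAxisymmetric (u t)) → HasRapidSpatialDecay (u 0) →
          ∃ T' δ : ℝ, T' < T ∧ 0 < δ ∧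
            ∀ t ∈ Ico T' T, ∀ x, cylRadius x < δ → -ν ≤ x 0 * u t x 0 + x 1 * u t x 1 := by
  rw [axisymSwirlRegular_iff_aprioriRadialInflowBound_one]
  constructor
  · intro h ν T hν hT u p hcl hLH hbd hax hdec
    obtain ⟨δ, hδ, hin⟩ := h ν T hν hT u p hcl hLH hbd hax hdec
    exact ⟨0, δ, hT, hδ, hin⟩
  · intro h ν T hν hT u p hcl hLH hbd hax hdec
    obtain ⟨T', δ, hT'T, hδ, hin⟩ := h ν T hν hT u p hcl hLH hbd hax hdec
    rcases le_or_gt T' 0 with hT'0 | hT'0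
    · exact ⟨δ, hδ, fun t ht x hx => hin t ⟨hT'0.trans ht.1, ht.2⟩ x hx⟩
    · -- on `[0, T']` the solution is bounded: the bound holds on a thinner tube
      obtain ⟨M, hM⟩ := hbd T' hT'T
      obtain ⟨δ₁, hδ₁, hin₁⟩ :=
        exists_tube_radialMomentum_ge_neg_of_bound hν ⟨0, left_mem_Icc.2 hT'0.le⟩ hM
      refine ⟨min δ δ₁, lt_min hδ hδ₁, fun t ht x hx => ?_⟩
      rcases le_or_gt t T' with htT' | htT'
      · exact hin₁ t ⟨ht.1, htT'⟩ x (hx.trans_le (min_le_right _ _))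
      · exact hin t ⟨htT'.le, ht.2⟩ x (hx.trans_le (min_le_left _ _))

/-- **K1 of the sibling line «log-gate» is row-strength IN KERNEL:
`ScenarioCensus.LogGate.AprioriLogGate ↔ AxisymSwirlRegular`.** `→` is the landed composition
`ScenarioCensus.LogGate.AxisymSwirlRegular_of` (R `logGateCriterion_of` + K1). `←`: under the crux a solution
of the standing class is bounded by some `B ≥ 0` up to `T`
(`hasSmoothExtensionPast_and_bounded_of_axisymSwirlRegular`), so `u_r ≥ −B`, and on the tube
`0 < r ≤ δ₀ := min (1/4) (min e^{−3} (ν/(B+1)))` one has `log(1/r) ≥ 3` and `ν/r ≥ B + 1`, whence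
`E_{3,ν}(r) = ν(2 − 3/log(1/r))/r ≥ ν/r > B`: the solution passes the gate `HasLogGate 3 δ₀ ν T`
(velocity form of `ScenarioCensus.LogGate.hasLogGate_of_gradient_bound`, which asks for a gradient
bound instead). So K1, declared «F5-strength» in `ScenarioCensusRowF5lgGate`, is EQUIVALENT to the
leaf (and to `Row_F5`, `axisymSwirlRegular_iff_row_F5`). [folklore] -/
theorem aprioriLogGate_iff_axisymSwirlRegular :
    ScenarioCensus.LogGate.AprioriLogGate ↔ AxisymSwirlRegular := by
  constructor
  · exact ScenarioCensus.LogGate.AxisymSwirlRegular_of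
  · intro hAX ν T hν hT u p hcl hLH hdec _hbd hax
    obtain ⟨-, B, hB⟩ := hasSmoothExtensionPast_and_bounded_of_axisymSwirlRegular hAX hν hT hcl hLH
      (hax 0 (left_mem_Ico.2 hT)) hdec
    have hB0 : 0 ≤ B := (norm_nonneg _).trans (hB 0 (left_mem_Ico.2 hT) 0)
    have hB1 : (0 : ℝ) < B + 1 := by linarith
    refine ⟨3, min (1 / 4) (min (Real.exp (-3)) (ν / (B + 1))), by norm_num,
      lt_min (by norm_num) (lt_min (Real.exp_pos _) (div_pos hν hB1)),
      (min_le_left _ _).trans_lt (by norm_num), fun t ht x hr0 hrδ => ?_⟩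
    have hre : cylRadius x ≤ Real.exp (-3) :=
      hrδ.trans ((min_le_right _ _).trans (min_le_left _ _))
    have hrν : cylRadius x ≤ ν / (B + 1) :=
      hrδ.trans ((min_le_right _ _).trans (min_le_right _ _))
    have hur : -B ≤ radialVelocity (u t) x :=
      (neg_le_neg (hB t ht x)).trans (neg_norm_le_radialVelocity (u t) x)
    -- `log(1/r) ≥ 3`, hence `3/log(1/r) ≤ 1`
    have hℓ : 3 ≤ -Real.log (cylRadius x) := by
      have := Real.log_le_log hr0 hre
      rw [Real.log_exp] at this
      linarith
    have h3 : 3 / (-Real.log (cylRadius x)) ≤ 1 := (div_le_one (by linarith)).2 hℓ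
    -- `(B + 1) r ≤ ν`
    have hνr : (B + 1) * cylRadius x ≤ ν := by
      have := (le_div_iff₀ hB1).1 hrν
      linarith
    have hE : B ≤ ScenarioCensus.LogGate.logInflowEnvelope 3 ν (cylRadius x) := by
      unfold ScenarioCensus.LogGate.logInflowEnvelope
      rw [le_div_iff₀ hr0]
      calc B * cylRadius x ≤ ν := by nlinarith [hr0.le]
        _ = ν * 1 := (mul_one ν).symm
        _ ≤ ν * (2 - 3 / -Real.log (cylRadius x)) := mul_le_mul_of_nonneg_left (by linarith) hν.le
    linarith

/-- **Minimal no-blow-up form of the crux:** `AxisymSwirlRegular` holds iff every classical solution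
on `[0,T)` which is Leray–Hopf on `[0,T]` from a rapidly decaying AXISYMMETRIC DATUM extends
smoothly past `T` — the two further hypotheses of the standing class (boundedness on closed
sub-slabs, `slabBound_of_classical_lerayHopf`; axisymmetry of every slice `t ∈ [0,T)`) are
inessential: `→` is `hasSmoothExtensionPast_and_bounded_of_axisymSwirlRegular`, which never used
them; `←` specialises to the standing class and applies `axisymSwirlRegular_of_noBlowup`. [folklore] -/
theorem axisymSwirlRegular_iff_noBlowup_of_axisymmetric_datum :
    AxisymSwirlRegular ↔
      ∀ (ν T : ℝ), 0 < ν → 0 < T →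
        ∀ (u : ℝ → EuclideanSpace ℝ (Fin 3) → EuclideanSpace ℝ (Fin 3))
          (p : ℝ → EuclideanSpace ℝ (Fin 3) → ℝ),
          IsClassicalNSSolutionOn (Ico 0 T) ν 0 u p → IsLerayHopfOn T ν 0 (u 0) u →
          HasRapidSpatialDecay (u 0) → IsAxisymmetric (u 0) → HasSmoothExtensionPast ν 0 u T := by
  constructor
  · intro hAX ν T hν hT u p hcl hLH hdec hax0
    exact (hasSmoothExtensionPast_and_bounded_of_axisymSwirlRegular hAX hν hT hcl hLH hax0 hdec).1
  · intro h
    exact axisymSwirlRegular_of_noBlowup fun ν T hν hT u p hcl hLH _hbd hax hdec =>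
      h ν T hν hT u p hcl hLH hdec (hax 0 (left_mem_Ico.2 hT))

end Summit.NavierStokesRegularity.NavierStokesRegularity.Theorems

end
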